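import Summits.ABC.IUTFork.Cor312VolumesRealDH
import Literature.IUT.LogVolume.IntegerRingFinite
import HarnessLib

/-!
# [IUTchIII] Thm. 3.11 (i) (Ind2) at the Dupuy–Hilado-level signature — Ism is FULL: every shell-preserving `ℚ_p`-linear
# automorphism of `F_v` is an Ism-element (the `hfull` discharger of `Cor312Vol.exists_indGroup_comparison_eq_congr` at `presAt`)

PROOF-ONLY file (D-0012; no definitions, no `Prop` facts) of the abc-iut cell (R2 S-chain seat abc-iut-s2-p9, gen 0). TAKES NO SIDE on
[IUTchIII] Cor. 3.12. The F- and K-level twin of this seat's M-level `exists_ism_presAtM_of_image_logUnits_eq` (`Cor312ThetaSideEqualM`,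
p448956), for abc-iut-c312-5's `Real.padicPresentationDH X p logv hlog` of `Real.logShellsDH X logv` (Ism slot `Real.ismDH` = the
bicontinuous `ℚ`-linear automorphisms of `F_v` mapping the log-shell onto itself, Dupuy–Hilado §4.9): a `ℚ_p`-linear automorphism of the
rescaled completion `F_v` mapping `log_p(𝒪^×)` onto itself is continuous with continuous inverse (finite dimension over `ℚ_p`) and maps the
shell `(p^*)⁻¹·log_p(𝒪^×)` onto itself — so it IS an element of `Real.ismDH` (**`exists_ismDH_presAt_of_image_logUnits_eq`**). This is the
hypothesis `hfull` of this seat's generic `Cor312Vol.exists_indGroup_comparison_eq_congr` (`Cor312ThetaLocalGeContentHull`, p448133) at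
the F- and K-level presentations (the `hism` input of the per-packet REVERSE inequality `sum_content_hull_le_thetaLocal_untopD` there).
[cite: DupuyHilado2025, §4.9] [cite: Mochizuki2012, IUTchIII Thm. 3.11 (i) (Ind2) p. 154] [claim: Mochizuki2012, status: disputed] for the
quoted signature. HONEST FRAMING: a property of the TYPED signature; nothing asserted about Cor. 3.12; typed ≠ proved.
-/

noncomputable section

open Set Function NumberField IsDedekindDomain
open scoped Pointwise

namespace Summit.ABC.IUTFork.Thm311.Real

open Cor312Vol Literature.IUT.LogThetaLattice Literature.IUT.LogVolume Literature.NumberTheory.NumberFields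

variable {F : Type} [Field F] [NumberField F] (X : PilotData F) (p : ℕ) [hp : Fact p.Prime]

/-- **FULLNESS of Ism at the Dupuy–Hilado-level signature** (§4.9: `Aut_{ℚ_p}(F_v : I_v)` = ALL lattice automorphisms): a `ℚ_p`-linear
automorphism `g'` of the presented field `F_v` (c312-5's `padicPresentationDH`, `φ_v = id`) mapping `log_p(𝒪^×)` onto itself is (intertwined
with) an element of `Real.ismDH logv v` — bicontinuous by finite-dimensionality, shell-preserving since the shell is `(p^*)⁻¹·log_p(𝒪^×)`.
[cite: DupuyHilado2025, §4.9] -/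
theorem exists_ismDH_presAt_of_image_logUnits_eq (logv : PadicLogs F) (hlog : LogvAnalyticAt p logv)
    (x : (thetaIndex X).Fibre (.inr (ratPrime p)))
    (g' : (padicPresentationDH X p logv hlog).k x ≃ₗ[ℚ_[p]] (padicPresentationDH X p logv hlog).k x)
    (hg' : g' '' Literature.IUT.LogVolume.logUnits ((padicPresentationDH X p logv hlog).k x) =
      Literature.IUT.LogVolume.logUnits ((padicPresentationDH X p logv hlog).k x)) :
    ∃ g ∈ (logShellsDH X logv).ism x.1, ∀ y, (padicPresentationDH X p logv hlog).φ x (g y) = g' ((padicPresentationDH X p logv hlog).φ x y) := by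
  obtain ⟨x1, h⟩ := x
  rcases x1 with w | v
  · exact absurd h (by simp [thetaIndex])
  · haveI hfd : FiniteDimensional ℚ_[p] ((padicPresentationDH X p logv hlog).k ⟨Sum.inr v, h⟩) :=
      Literature.IUT.LogVolume.finiteDimensional p ((padicPresentationDH X p logv hlog).k ⟨Sum.inr v, h⟩)
    have hc : Continuous g' := by
      have h := g'.toContinuousLinearEquiv.continuous
      rwa [LinearEquiv.coe_toContinuousLinearEquiv'] at h
    have hc' : Continuous g'.symm := by
      have h := g'.toContinuousLinearEquiv.symm.continuous
      rwa [LinearEquiv.coe_toContinuousLinearEquiv_symm'] at h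
    -- the shell is `c • log_p(𝒪^×)` (`φ = id`)
    have hshell : (logShellsDH X logv).shell (Sum.inr v) =
        (padicPresentationDH X p logv hlog).c • Literature.IUT.LogVolume.logUnits ((padicPresentationDH X p logv hlog).k ⟨Sum.inr v, h⟩) := by
      have h := (padicPresentationDH X p logv hlog).shell_eq ⟨Sum.inr v, h⟩
      rw [← h]
      ext a
      exact ⟨fun ha => ⟨a, ha, rfl⟩, fun ⟨b, hb, hba⟩ => hba ▸ hb⟩
    have himg : g' '' ((padicPresentationDH X p logv hlog).c •
        Literature.IUT.LogVolume.logUnits ((padicPresentationDH X p logv hlog).k ⟨Sum.inr v, h⟩)) =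
        (padicPresentationDH X p logv hlog).c • Literature.IUT.LogVolume.logUnits ((padicPresentationDH X p logv hlog).k ⟨Sum.inr v, h⟩) := by
      conv_rhs => rw [← hg']
      rw [← Set.image_smul, ← Set.image_smul, Set.image_image, Set.image_image]
      exact Set.image_congr fun a _ => map_smul g' _ a
    refine ⟨g'.restrictScalars ℚ, ?_, fun y => rfl⟩
    refine ⟨hc, hc', ?_⟩
    show g'.restrictScalars ℚ '' (logShellsDH X logv).shell (Sum.inr v) = (logShellsDH X logv).shell (Sum.inr v)
    rw [hshell]
    exact himg

end Summit.ABC.IUTFork.Thm311.Real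

end
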